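import Literature.Computability.Complexity.BoundedArithmeticHerbrand
import Literature.Computability.MetaComplexity.BoundedArithUnivPIND
import HarnessLib

/-!
# Buss's conservation theorem: `S₂ⁱ⁺¹` is `∀Σᵇᵢ₊₁`-conservative over `T₂ⁱ` (`i ≥ 1`)

Topic `Literature/Computability/Complexity`.  This file supplies the data of the
Herbrand-saturation route (`HerbrandRouteData`, `BoundedArithmeticHerbrand.lean`) for every
`i = k + 1 ≥ 1` — the language `Language.qsym k` of query-presentable (`Qₖ₊₁`-definable)
function symbols, the universal theory `QSym.univTheory k` of the canonical expansions of the
models of `T₂ᵏ⁺¹`, the universal companions of `Πᵇₖ₊₂` formulas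
(`QSym.exists_universal_of_isPib`) and `Σᵇₖ₊₂`-PIND in Herbrand-saturated models
(`QSym.model_S2_of_isHerbrandSaturated`), all from `Literature/Computability/MetaComplexity/
BoundedArith{Symbols,UnivTheory,UnivSkolem,UnivEngine,UnivStrict,UnivPIND}.lean` — and concludes
**Buss's theorem** `S2_succ_isConservativeOver_T2` (Buss 1990, Thm. 5 / Main Theorem) via
`S2_succ_isConservativeOver_T2_of_herbrandRouteData`.

The proof is the model-theoretic one (Avigad 2002, Thm. 3.4; Krajíček 1995, §7.6 / Zambella
1996): a model `M ⊨ T₂ⁱ` expands to the universal theory, embeds universal-preservingly into a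
Herbrand-saturated model `K`, which satisfies `S₂ⁱ⁺¹`; `Πᵇᵢ₊₁` statements transfer back through
their universal companions.  The combinatorial core (Buss 1990, §3–§4: `Qᵢ`-definable functions
are closed under composition, definition by cases, bounded minimisation and limited iteration in
`T₂ⁱ`; strict `Σᵇ` forms; induction along the notation of `b`) is carried out semantically in
the `MetaComplexity` files.

## References

* S. R. Buss, *Axiomatizations and conservation results for fragments of bounded arithmetic*,
  in: Logic and Computation, Contemp. Math. 106, AMS 1990, pp. 57–84, Thm. 5 (p. 8).
* J. Avigad, *Saturated models of universal theories*, APAL 118 (2002), Thm. 3.4.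
* J. Krajíček, *Bounded Arithmetic, Propositional Logic and Complexity Theory*, CUP 1995,
  Thm. 7.2.4, §7.6.
-/

namespace Literature.Computability.Complexity

open FirstOrder FirstOrder.Language
open Literature.Computability.MetaComplexity

/-- **The data of the Herbrand-saturation route for `i = k + 1`**: the language
`Language.qsym k`, the map `qsymι k`, the universal theory `QSym.univTheory k`.
[cite: BussContempMath1990, Thm. 5] -/
theorem herbrandRouteData_qsym (k : ℕ) :
    HerbrandRouteData (k + 1) (qsymι k) (QSym.univTheory k) where
  isUniversal := QSym.isUniversal_univTheory k
  expands := fun M _ hM => QSym.expands_univTheory M hM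
  exists_universal := fun φ hφ => QSym.exists_universal_of_isPib φ hφ
  model_S2_succ := fun K _ hK hsat => QSym.model_S2_of_isHerbrandSaturated K hK hsat

/-- **Buss's conservation theorem** (Buss 1990, Thm. 5, p. 8; Main Theorem): for `i ≥ 1`,
`S₂ⁱ⁺¹` is `∀Σᵇᵢ₊₁`-conservative over `T₂ⁱ` — the named fact
`S2_succ_isConservativeOver_T2` of `BoundedArithmetic.lean` holds.
[cite: BussContempMath1990, Thm. 5 (p. 8)] -/
theorem S2_succ_isConservativeOver_T2_holds : S2_succ_isConservativeOver_T2 :=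
  S2_succ_isConservativeOver_T2_of_herbrandRouteData
    (L' := fun i => Language.qsym (i - 1)) (fun i => qsymι (i - 1))
    (fun i => QSym.univTheory (i - 1)) fun i hi => by
      obtain ⟨k, rfl⟩ : ∃ k, i = k + 1 := ⟨i - 1, (Nat.sub_add_cancel hi).symm⟩
      exact herbrandRouteData_qsym k

end Literature.Computability.Complexity
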